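import Mathlib.Analysis.SpecialFunctions.Pow.Real
import Mathlib.NumberTheory.Transcendental.Liouville.LiouvilleWith
import Summits.KontsevichZagierPeriods.Zeta5Search.Criteria
import Summits.KontsevichZagierPeriods.Zeta5Search.EffectiveMeasure
import HarnessLib

/-!
# ζ(5) search — the ROW CERTIFICATE: one kernel object per NEAR-MISSES / CANDIDATES row (cell `pub-zeta5`, certifier `cert-1`)

HONEST FRAMING: systematic search; no irrationality claim unless certified.

`CRITERIA.md` §0/C1 grades a family of rational approximating forms `ℓₙ = uₙ ξ − vₙ` by EXACT
exponential rates: coefficient growth `b = lim log|uₙ|/n`, decay `c = −lim log|ℓₙ|/n`, denominators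
`δ = lim log Dₙ/n` (all savings folded into the effective denominator `Dₙ`, so `φ = 0`), whence the
MARGIN `μ₁ = c − δ` and Brown–Zudilin's WORTHINESS `γ = 1 + μ₁/Q`, `Q = b + δ`. A HIT is `μ₁ > 0`
(then `ξ ∉ ℚ`, C1); a NEAR-MISS reports `μ₁ < 0` and `γ < 1` as comparison figures.

This file types exactly that row, in two tiers, so that "kernel-certified row" has ONE meaning:

* `RateCertificate ξ` — the ANALYTIC tier: `u, v : ℕ → ℚ` with PROVED limits
  `log|uₙ|/n → growthRate` and `log|uₙξ − vₙ|/n → −decayRate < 0`. Derived: `marginAt δ`,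
  `worthinessAt δ` for any denominator-rate MODEL `δ` (what a census row prices), the forms are
  eventually non-zero and tend to `0` (`forms_eventually_ne_zero`, `tendsto_root_abs_form`).
* `RowCertificate ξ` — the ARITHMETIC tier on top: effective denominators `Dₙ ∈ ℕ⁺` with
  `Dₙuₙ, Dₙvₙ ∈ ℤ` eventually and `log Dₙ/n → denomRate`, all PROVED. Derived: `margin`,
  `worthiness`; **`RowCertificate.irrational : 0 < margin → Irrational ξ`** (through the landed
  `irrational_of_rates`, C1 on rates) and the MEASURE
  **`RowCertificate.not_liouvilleWith : 0 < margin → (Casoratian ≠ 0 eventually) →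
  worthiness/(worthiness − 1) = 1 + Q/μ₁ < p → ¬ LiouvilleWith p ξ`** (through the landed C4
  `not_liouvilleWith_of_eventual_rates`).

So the SAME object is an irrationality certificate when its margin is positive and a graded
near-miss (exact `μ₁`, exact `γ`) otherwise; a candidate row "under certification" is a
`RateCertificate` whose upgrade to a `RowCertificate` (proved denominators) is pending.
Instances: `Certificates/AperyRow.lean` (hit, calibration), `Certificates/SymmetricRow.lean`
(Brown–Zudilin totally symmetric = Zudilin 2002, near-miss `γ = 0.77796…`). No named facts.
-/

noncomputable section

open Filter Topology

namespace Summit.KontsevichZagierPeriods.Zeta5Search.Certificates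

/-! ### Analytic tier -/

/-- **Rate certificate** (analytic tier of a NEAR-MISSES row): rational forms `uₙ ξ − vₙ` with the
EXACT rates `log|uₙ|/n → growthRate` and `log|uₙ ξ − vₙ|/n → −decayRate`, `decayRate > 0`. -/
structure RateCertificate (ξ : ℝ) where
  /-- the coefficients `uₙ` of `ξ` (Apéry's `bₙ`, Brown–Zudilin's `Qₙ`) -/
  u : ℕ → ℚ
  /-- the companions `vₙ` (Apéry's `aₙ`, Brown–Zudilin's `Pₙ`) -/
  v : ℕ → ℚ
  /-- `b`: the exponential growth rate of `|uₙ|` -/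
  growthRate : ℝ
  /-- `c`: the exponential decay rate of the forms `|uₙ ξ − vₙ|` -/
  decayRate : ℝ
  /-- `log|uₙ|/n → b` -/
  tendsto_growth : Tendsto (fun n : ℕ => Real.log |(u n : ℝ)| / n) atTop (𝓝 growthRate)
  /-- `log|uₙ ξ − vₙ|/n → −c` -/
  tendsto_decay :
    Tendsto (fun n : ℕ => Real.log |(u n : ℝ) * ξ - v n| / n) atTop (𝓝 (-decayRate))
  /-- `c > 0` (the forms do tend to zero) -/
  decayRate_pos : 0 < decayRate

namespace RateCertificate

variable {ξ : ℝ} (C : RateCertificate ξ)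

/-- The raw form `ℓₙ = uₙ ξ − vₙ`. -/
def form (n : ℕ) : ℝ := (C.u n : ℝ) * ξ - C.v n

/-- The margin `μ₁(δ) = c − δ` the row would have with effective denominators of rate `δ`
(CRITERIA C1 with `φ` folded into `δ`). -/
def marginAt (δ : ℝ) : ℝ := C.decayRate - δ

/-- Brown–Zudilin's worthiness `γ(δ) = 1 + μ₁(δ)/(b + δ)` the row would have with effective
denominators of rate `δ` (`|ξ − vₙ/uₙ| = (Dₙ|uₙ|)^{−γ+o(1)}`). -/
def worthinessAt (δ : ℝ) : ℝ := 1 + C.marginAt δ / (C.growthRate + δ)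

/-- The forms are eventually non-zero (a vanishing form would put `log|ℓₙ|/n = 0`, not near `−c < 0`). -/
theorem forms_eventually_ne_zero : ∀ᶠ n : ℕ in atTop, C.form n ≠ 0 := by
  have hc : -C.decayRate < 0 := by linarith [C.decayRate_pos]
  filter_upwards [C.tendsto_decay.eventually (gt_mem_nhds hc)] with n hn
  intro h0
  rw [form] at h0
  rw [h0, abs_zero, Real.log_zero, zero_div] at hn
  exact lt_irrefl _ hn

/-- The forms are non-zero infinitely often. -/
theorem forms_frequently_ne_zero : ∃ᶠ n : ℕ in atTop, C.form n ≠ 0 :=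
  C.forms_eventually_ne_zero.frequently

/-- Root form of the decay rate: `|uₙ ξ − vₙ|^{1/n} → e^{−c}`. -/
theorem tendsto_root_abs_form :
    Tendsto (fun n : ℕ => |C.form n| ^ (1 / (n : ℝ))) atTop (𝓝 (Real.exp (-C.decayRate))) := by
  have h1 := (Real.continuous_exp.tendsto _).comp C.tendsto_decay
  refine h1.congr' ?_
  filter_upwards [C.forms_eventually_ne_zero] with n hn
  simp only [Function.comp]
  rw [Real.rpow_def_of_pos (abs_pos.2 hn), form]
  congr 1
  ring

/-- The forms tend to zero. -/
theorem tendsto_form : Tendsto C.form atTop (𝓝 0) := by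
  have hc := C.decayRate_pos
  have hlt : C.decayRate / 2 < -Real.log (Real.exp (-C.decayRate)) := by
    rw [Real.log_exp]; linarith
  have hev := eventually_abs_le_exp_of_tendsto_root (Real.exp_pos _) C.tendsto_root_abs_form hlt
  have hlim : Tendsto (fun n : ℕ => Real.exp (-(C.decayRate / 2 * n))) atTop (𝓝 0) := by
    have h1 : Tendsto (fun n : ℕ => C.decayRate / 2 * (n : ℝ)) atTop atTop :=
      tendsto_natCast_atTop_atTop.const_mul_atTop (by linarith)
    have h2 := Real.tendsto_exp_neg_atTop_nhds_zero.comp h1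
    exact h2
  refine squeeze_zero_norm' ?_ hlim
  filter_upwards [hev] with n hn
  rw [Real.norm_eq_abs]
  exact hn

/-- If the coefficients do not vanish eventually (e.g. `uₙ > 0`), the quotients converge:
`vₙ/uₙ → ξ` as soon as `|uₙ| ≥ 1` eventually. -/
theorem tendsto_div (hu : ∀ᶠ n : ℕ in atTop, 1 ≤ |(C.u n : ℝ)|) :
    Tendsto (fun n : ℕ => (C.v n : ℝ) / C.u n) atTop (𝓝 ξ) := by
  have h0 := C.tendsto_form
  -- `ξ − v/u = ℓ/u`, `|ℓ/u| ≤ |ℓ|`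
  have h1 : Tendsto (fun n : ℕ => C.form n / C.u n) atTop (𝓝 0) := by
    refine squeeze_zero_norm' ?_ (tendsto_norm_zero.comp h0 |>.congr fun n => rfl)
    filter_upwards [hu] with n hn
    rw [norm_div, Real.norm_eq_abs, Real.norm_eq_abs]
    exact div_le_self (abs_nonneg _) hn
  have h2 : Tendsto (fun n : ℕ => ξ - C.form n / C.u n) atTop (𝓝 (ξ - 0)) :=
    tendsto_const_nhds.sub h1
  rw [sub_zero] at h2
  refine h2.congr' ?_
  filter_upwards [hu] with n hn
  have hne : (C.u n : ℝ) ≠ 0 := by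
    intro h; rw [h, abs_zero] at hn; exact absurd hn (by norm_num)
  rw [form]
  field_simp
  ring

end RateCertificate

/-! ### Arithmetic tier -/

/-- **Row certificate** = rate certificate + PROVEN effective denominators: `Dₙ ∈ ℕ⁺`,
`Dₙuₙ, Dₙvₙ ∈ ℤ` eventually, `log Dₙ/n → δ`. Its `margin = c − δ` and
`worthiness = 1 + margin/(b + δ)` are the row's exact `μ₁` and `γ`; `0 < margin → Irrational ξ`. -/
structure RowCertificate (ξ : ℝ) extends RateCertificate ξ where
  /-- the effective common denominators `Dₙ` (savings already divided out) -/
  denom : ℕ → ℕ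
  /-- `Dₙ > 0` -/
  denom_pos : ∀ n, 0 < denom n
  /-- `δ`: the exponential rate of `Dₙ` -/
  denomRate : ℝ
  /-- `log Dₙ/n → δ` -/
  tendsto_denom : Tendsto (fun n : ℕ => Real.log (denom n : ℝ) / n) atTop (𝓝 denomRate)
  /-- `Dₙ uₙ ∈ ℤ` eventually -/
  isInt_u : ∀ᶠ n : ℕ in atTop, ∃ z : ℤ, (denom n : ℚ) * u n = z
  /-- `Dₙ vₙ ∈ ℤ` eventually -/
  isInt_v : ∀ᶠ n : ℕ in atTop, ∃ z : ℤ, (denom n : ℚ) * v n = z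

namespace RowCertificate

variable {ξ : ℝ} (C : RowCertificate ξ)

/-- The row's MARGIN `μ₁ = c − δ` (nats per step; CRITERIA C1 with `φ` folded into `δ`). -/
def margin : ℝ := C.decayRate - C.denomRate

/-- The row's coefficient rate `Q = b + δ` (growth of the integer coefficients `Dₙuₙ`). -/
def coeffRate : ℝ := C.growthRate + C.denomRate

/-- The row's WORTHINESS `γ = 1 + μ₁/Q` (Brown–Zudilin; `γ > 1` iff the row is a hit). -/
def worthiness : ℝ := 1 + C.margin / C.coeffRate

/-- `margin` is `marginAt δ` of the underlying rate certificate. -/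
theorem margin_eq_marginAt : C.margin = C.toRateCertificate.marginAt C.denomRate := rfl

/-- `worthiness` is `worthinessAt δ` of the underlying rate certificate. -/
theorem worthiness_eq_worthinessAt :
    C.worthiness = C.toRateCertificate.worthinessAt C.denomRate := rfl

open scoped Classical in
/-- The integer coefficient of `ξ`: `Dₙuₙ` (as an integer where it is one, else `0`). -/
def intU (n : ℕ) : ℤ := if h : ∃ z : ℤ, (C.denom n : ℚ) * C.u n = z then h.choose else 0

open scoped Classical in
/-- The integer companion: `Dₙvₙ` (as an integer where it is one, else `0`). -/
def intV (n : ℕ) : ℤ := if h : ∃ z : ℤ, (C.denom n : ℚ) * C.v n = z then h.choose else 0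

/-- Eventually `intU n = Dₙuₙ`. -/
theorem intU_spec : ∀ᶠ n : ℕ in atTop, (C.intU n : ℚ) = (C.denom n : ℚ) * C.u n := by
  filter_upwards [C.isInt_u] with n hn
  rw [intU, dif_pos hn]
  exact hn.choose_spec.symm

/-- Eventually `intV n = Dₙvₙ`. -/
theorem intV_spec : ∀ᶠ n : ℕ in atTop, (C.intV n : ℚ) = (C.denom n : ℚ) * C.v n := by
  filter_upwards [C.isInt_v] with n hn
  rw [intV, dif_pos hn]
  exact hn.choose_spec.symm

/-- The arithmetic of the forms: `Dₙ ℓₙ = −intV n + intU n · ξ` eventually. -/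
theorem arith : ∀ᶠ n : ℕ in atTop,
    (C.denom n : ℝ) * C.form n = ((1 : ℕ) : ℝ) * ((-C.intV n : ℤ) + (C.intU n : ℤ) * ξ) := by
  filter_upwards [C.intU_spec, C.intV_spec] with n hu hv
  have hu' : ((C.intU n : ℤ) : ℝ) = (C.denom n : ℝ) * (C.u n : ℝ) := by exact_mod_cast hu
  have hv' : ((C.intV n : ℤ) : ℝ) = (C.denom n : ℝ) * (C.v n : ℝ) := by exact_mod_cast hv
  rw [RateCertificate.form]
  push_cast
  rw [hu', hv']
  ring

/-- **C1: a row with positive margin certifies irrationality.** -/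
theorem irrational (h : 0 < C.margin) : Irrational ξ := by
  have hΦ : Tendsto (fun n : ℕ => Real.log (((1 : ℕ) : ℕ) : ℝ) / n) atTop (𝓝 0) := by
    simp
  refine irrational_of_rates C.form C.denom (fun _ => 1) (fun n => -C.intV n) (fun n => C.intU n)
    C.denom_pos (fun _ => Nat.one_pos) ?_ (Real.exp_pos _) C.tendsto_root_abs_form C.tendsto_denom
    hΦ C.forms_frequently_ne_zero ?_
  · exact C.arith
  · rw [Real.log_exp]; rw [margin] at h; linarith

/-! ### The measure (C4) -/

/-- Eventually `|intU r| ≤ e^{Q' r}` for every `Q' > Q = b + δ`. -/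
theorem eventually_abs_intU_le {Q' : ℝ} (hQ' : C.coeffRate < Q') :
    ∀ᶠ r : ℕ in atTop, |(C.intU r : ℝ)| ≤ 1 * Real.exp (Q' * r) := by
  -- `log(Dᵣ|uᵣ|)/r → δ + b < Q'`; where `uᵣ = 0` the bound is trivial
  have hsum := C.tendsto_denom.add C.tendsto_growth
  have hlt : C.denomRate + C.growthRate < Q' := by rw [coeffRate] at hQ'; linarith
  have hev := hsum.eventually (Iio_mem_nhds hlt)
  filter_upwards [hev, C.intU_spec, eventually_gt_atTop 0] with r hr hu hr0
  have hu' : ((C.intU r : ℤ) : ℝ) = (C.denom r : ℝ) * (C.u r : ℝ) := by exact_mod_cast hu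
  rw [one_mul, hu', abs_mul, Nat.abs_cast]
  by_cases h0 : (C.u r : ℝ) = 0
  · rw [h0, abs_zero, mul_zero]; exact (Real.exp_pos _).le
  · have hD : (0 : ℝ) < C.denom r := by exact_mod_cast C.denom_pos r
    have hpos : 0 < (C.denom r : ℝ) * |(C.u r : ℝ)| := mul_pos hD (abs_pos.2 h0)
    have hr0' : (0 : ℝ) < r := by exact_mod_cast hr0
    rw [← Real.exp_log hpos, Real.exp_le_exp, Real.log_mul hD.ne' (abs_pos.2 h0).ne']
    rw [← add_div, div_lt_iff₀ hr0'] at hr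
    exact hr.le

/-- Eventually `|intU r · ξ − intV r| ≤ e^{−σ' r}` for every `σ' < μ₁ = c − δ`. -/
theorem eventually_abs_intForm_le {σ' : ℝ} (hσ' : σ' < C.margin) :
    ∀ᶠ r : ℕ in atTop, |(C.intU r : ℝ) * ξ - C.intV r| ≤ 1 * Real.exp (-(σ' * r)) := by
  -- `log(Dᵣ|ℓᵣ|)/r → δ − c < −σ'`
  have hsum := C.tendsto_denom.add C.tendsto_decay
  have hlt : C.denomRate + -C.decayRate < -σ' := by rw [margin] at hσ'; linarith
  have hev := hsum.eventually (Iio_mem_nhds hlt)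
  filter_upwards [hev, C.intU_spec, C.intV_spec, C.forms_eventually_ne_zero, eventually_gt_atTop 0]
    with r hr hu hv hne hr0
  have hu' : ((C.intU r : ℤ) : ℝ) = (C.denom r : ℝ) * (C.u r : ℝ) := by exact_mod_cast hu
  have hv' : ((C.intV r : ℤ) : ℝ) = (C.denom r : ℝ) * (C.v r : ℝ) := by exact_mod_cast hv
  have e : (C.intU r : ℝ) * ξ - C.intV r = (C.denom r : ℝ) * C.form r := by
    rw [hu', hv', RateCertificate.form]; ring
  have hD : (0 : ℝ) < C.denom r := by exact_mod_cast C.denom_pos r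
  have hℓ : 0 < |C.form r| := abs_pos.2 hne
  have hpos : 0 < (C.denom r : ℝ) * |C.form r| := mul_pos hD hℓ
  have hr0' : (0 : ℝ) < r := by exact_mod_cast hr0
  rw [one_mul, e, abs_mul, Nat.abs_cast, ← Real.exp_log hpos, Real.exp_le_exp,
    Real.log_mul hD.ne' hℓ.ne', RateCertificate.form]
  rw [← add_div, div_lt_iff₀ hr0'] at hr
  linarith

/-- **C4: the measure of a hit.** If the margin is positive and the Casoratian `uₙvₙ₊₁ − uₙ₊₁vₙ`
is eventually non-zero, then `¬ LiouvilleWith p ξ` for every `p > 1 + Q/μ₁ = γ/(γ−1)`: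
the irrationality exponent of `ξ` is at most `1 + (b + δ)/(c − δ)`. -/
theorem not_liouvilleWith (h : 0 < C.margin) (hQ : 0 < C.coeffRate)
    (hW : ∀ᶠ n : ℕ in atTop, C.u n * C.v (n + 1) ≠ C.u (n + 1) * C.v n) {p : ℝ}
    (hp : 1 + C.coeffRate / C.margin < p) : ¬ LiouvilleWith p ξ := by
  -- choose `ε > 0` with `(Q+ε)/(μ₁−ε) + 1 < p` by continuity at `ε = 0`
  have hcont : Tendsto (fun ε : ℝ => (C.coeffRate + ε) / (C.margin - ε) + 1) (𝓝[>] 0)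
      (𝓝 (C.coeffRate / C.margin + 1)) := by
    have h1 : Tendsto (fun ε : ℝ => (C.coeffRate + ε) / (C.margin - ε) + 1) (𝓝 0)
        (𝓝 ((C.coeffRate + 0) / (C.margin - 0) + 1)) := by
      refine ((tendsto_const_nhds.add tendsto_id).div (tendsto_const_nhds.sub tendsto_id) ?_).add
        tendsto_const_nhds
      simpa using h.ne'
    simp only [add_zero, sub_zero] at h1
    exact h1.mono_left nhdsWithin_le_nhds
  have hp' : C.coeffRate / C.margin + 1 < p := by linarith
  have hev : ∀ᶠ ε in 𝓝[>] (0 : ℝ), (C.coeffRate + ε) / (C.margin - ε) + 1 < p ∧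
      (ε ∈ Set.Ioi (0 : ℝ) ∧ ε ∈ Set.Ioo (0 : ℝ) C.margin) :=
    (hcont.eventually (Iio_mem_nhds hp')).and
      (eventually_mem_nhdsWithin.and (Ioo_mem_nhdsGT (show (0 : ℝ) < C.margin from h)))
  obtain ⟨ε, hεp, hε0, hεσ⟩ := hev.exists
  rw [Set.mem_Ioi] at hε0
  have hσ : 0 < C.margin - ε := by linarith [hεσ.2]
  have hQ' : 0 < C.coeffRate + ε := by linarith
  -- integer data
  have hq := C.eventually_abs_intU_le (Q' := C.coeffRate + ε) (by linarith)
  have ha := C.eventually_abs_intForm_le (σ' := C.margin - ε) (by linarith)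
  have hne : ∀ᶠ r : ℕ in atTop, C.intV r * C.intU (r + 1) ≠ C.intV (r + 1) * C.intU r := by
    have hs1 : ∀ᶠ r : ℕ in atTop, (C.intU (r + 1) : ℚ) = (C.denom (r + 1) : ℚ) * C.u (r + 1) :=
      (tendsto_add_atTop_nat 1).eventually C.intU_spec
    have hs2 : ∀ᶠ r : ℕ in atTop, (C.intV (r + 1) : ℚ) = (C.denom (r + 1) : ℚ) * C.v (r + 1) :=
      (tendsto_add_atTop_nat 1).eventually C.intV_spec
    filter_upwards [hW, C.intU_spec, C.intV_spec, hs1, hs2] with r hr hu hv hu1 hv1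
    intro heq
    apply hr
    have hD : (C.denom r : ℚ) ≠ 0 := by exact_mod_cast (C.denom_pos r).ne'
    have hD1 : (C.denom (r + 1) : ℚ) ≠ 0 := by exact_mod_cast (C.denom_pos (r + 1)).ne'
    have heq' : (C.intV r : ℚ) * C.intU (r + 1) = (C.intV (r + 1) : ℚ) * C.intU r := by
      exact_mod_cast heq
    rw [hu, hv, hu1, hv1] at heq'
    have : (C.denom r : ℚ) * (C.denom (r + 1) : ℚ) * (C.u r * C.v (r + 1) - C.u (r + 1) * C.v r) = 0 := by
      linear_combination -heq'
    rcases mul_eq_zero.1 this with h1 | h1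
    · exact absurd h1 (mul_ne_zero hD hD1)
    · linarith
  exact not_liouvilleWith_of_eventual_rates hσ hQ' one_pos one_pos hq ha hne hεp

end RowCertificate

end Summit.KontsevichZagierPeriods.Zeta5Search.Certificates
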